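import Mathlib
import Summits.Schanuel.Schanuel.Theorems.RigidCoreMinimalCounterexampleInAclHitSetArithmeticalArithHierarchy

/-!
# Ring-definable primitive recursion with integer-vector state (Gödel's β-function device over `ℤ`)
# (crux stmt-Schanuel-0969 `RigidCore.MinimalCounterexampleInAcl`, line kernel-arithmetic-selection, stub S8‴)

`--supports stmt-Schanuel-0969`; foundation layer under `stub_corankOne_hitSetRingDefinable` (S8‴).  The exponential enclosures of
the hit-pattern presentation are Taylor partial sums — VARIABLE-LENGTH exact computations on Gaussian rationals.  This file turns
any such loop into a ring-definable function:

* `ringDefinableFun_natBeta` — Gödel's `β` as a total ring-definable function `(c, i) ↦ β(c⁺, i⁺)` of definable arguments (from the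
  definable β-graph `ringDefinable_natBetaGraph` of `…HitSetArithmeticalRingDef.lean`);
* `ringDefinable_setOf_forallFin` — finite conjunctions;
* **`ringDefinableMap_natRec`** — if `seq v 0 = base v` and `seq v (n+1) = step v n (seq v n)` with `base : ℤ^σ → ℤ^d` and
  `step : ℤ^σ × ℤ × ℤ^d → ℤ^d` ring-definable maps, then `(v, n) ↦ seq v n⁺ ∈ ℤ^d` is a ring-definable map.  Proof: an integer
  sequence is the difference of two sequences of naturals, each named by a β-code (`exists_beta_eq`), so "`y = seq v n`" says
  "there are `2d` codes whose decoded differences start at `base v`, obey `step` below `n`, and end at `y`" (`natRec_graph_eq`).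

Registered helper stub: `ringDefinable_natRec_fin` (the `Fin k`-parameter form).

References: K. Gödel, Monatsh. Math. Phys. 38 (1931), Satz VII with Hilfssatz 1 (β-function); R. Kaye, *Models of Peano
Arithmetic* (1991), §3.1.
-/

-- the summit namespace `Summit.Schanuel.Schanuel.…` repeats a component by design (D-0022)
set_option linter.dupNamespace false

open Set FirstOrder FirstOrder.Language

namespace Summit.Schanuel.Schanuel.Cruxes.MinimalCounterexampleInAcl.KernelArithmeticSelection

open Literature.ModelTheory.ExponentialFields

/-! ## Finite conjunctions; Gödel's β as a definable function -/

section General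

variable {L : Language} {M : Type*} [L.Structure M] {A : Set M} {α : Type*}

/-- A conjunction indexed by a finite type of definable conditions is definable. [folklore] -/
theorem definable_setOf_forallFin {ι : Type*} [Finite ι] {P : ι → (α → M) → Prop}
    (h : ∀ i, A.Definable L {v : α → M | P i v}) : A.Definable L {v : α → M | ∀ i, P i v} := by
  rw [setOf_forall]
  exact definable_iInter_of_finite h

end General

section RingZ

variable [FirstOrder.Ring.CompatibleRing ℤ] {α : Type*}

/-- Gödel's β-function, read as the total integer function `(c, i) ↦ β(c.toNat, i.toNat)`, applied to ring-definable arguments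
is a ring-definable function. [folklore] -/
theorem ringDefinableFun_natBeta {f g : (α → ℤ) → ℤ} (hf : (∅ : Set ℤ).DefinableFun Language.ring f)
    (hg : (∅ : Set ℤ).DefinableFun Language.ring g) :
    (∅ : Set ℤ).DefinableFun Language.ring (fun v => (Nat.beta (f v).toNat (g v).toNat : ℤ)) := by
  refine definableFun_apply₂_params (h := fun x y : ℤ => (Nat.beta x.toNat y.toNat : ℤ)) ?_ hf hg
  have h : (∅ : Set ℤ).Definable Language.ring {u : Fin 3 → ℤ | ∃ w : Fin 2 → ℤ,
      w 0 = ((u 0).toNat : ℤ) ∧ w 1 = ((u 1).toNat : ℤ) ∧ ![w 0, w 1, u 2] ∈ {t : Fin 3 → ℤ | 0 ≤ t 0 ∧ 0 ≤ t 1 ∧ t 2 = (Nat.beta (t 0).toNat (t 1).toNat : ℤ)}} :=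
    definable_setOf_existsBlock (definable_setOf_and_params
      (definable_setOf_eq_params (definableFun_proj_params _) (ringDefinableFun_toNat (definableFun_proj_params _)))
      (definable_setOf_and_params
      (definable_setOf_eq_params (definableFun_proj_params _) (ringDefinableFun_toNat (definableFun_proj_params _)))
      (ringDefinable_atom₃ ringDefinable_natBetaGraph (definableFun_proj_params _) (definableFun_proj_params _)
        (definableFun_proj_params _))))
  convert h using 1
  ext u
  simp only [mem_setOf_eq, Matrix.cons_val_zero, Matrix.cons_val_one, Matrix.cons_val]
  constructor
  · intro hu
    exact ⟨![((u 0).toNat : ℤ), ((u 1).toNat : ℤ)], rfl, rfl, Int.natCast_nonneg _, Int.natCast_nonneg _,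
      by simpa only [Matrix.cons_val_zero, Matrix.cons_val_one, Int.toNat_natCast] using hu⟩
  · rintro ⟨w, hw0, hw1, -, -, hu⟩
    rw [hw0, hw1, Int.toNat_natCast, Int.toNat_natCast] at hu
    exact hu

omit [FirstOrder.Ring.CompatibleRing ℤ] in
/-- Decoding: the integer named at place `k` by a pair of β-codes is `β(c, k) − β(c', k)`; every finite integer sequence is so
named (two applications of the β-lemma `exists_beta_eq`, to the positive and negative parts). [folklore] -/
theorem exists_beta_pair_eq (s : ℕ → ℤ) (n : ℕ) :
    ∃ c c' : ℕ, ∀ k ≤ n, (Nat.beta c k : ℤ) - (Nat.beta c' k : ℤ) = s k := by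
  obtain ⟨c, hc⟩ := exists_beta_eq (fun k => (s k).toNat) n
  obtain ⟨c', hc'⟩ := exists_beta_eq (fun k => (-(s k)).toNat) n
  refine ⟨c, c', fun k hk => ?_⟩
  rw [hc k hk, hc' k hk]
  exact Int.toNat_sub_toNat_neg (s k)

/-! ## The graph of a primitive recursion with `ℤ^d`-valued state -/

variable {σ : Type*} {d : ℕ}

omit [FirstOrder.Ring.CompatibleRing ℤ] in
/-- **The graph of a vector-valued primitive recursion, through β-codes.**  For `seq v 0 = base v`,
`seq v (n+1) = step v n (seq v n)`: `y = seq v n` iff there are codes `c, c' ∈ ℕ^d` such that the decoded vectors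
`z(k) = (β(cᵢ, k) − β(c'ᵢ, k))ᵢ` satisfy `z(0) = base v`, `z(k+1) = step v k (z k)` for `k < n`, and `z(n) = y`. [folklore] -/
theorem natRec_graph_iff {base : (σ → ℤ) → Fin d → ℤ} {step : (σ → ℤ) → ℤ → (Fin d → ℤ) → Fin d → ℤ}
    {seq : (σ → ℤ) → ℕ → Fin d → ℤ} (h0 : ∀ v, seq v 0 = base v) (hS : ∀ v n, seq v (n + 1) = step v n (seq v n))
    (v : σ → ℤ) (n : ℕ) (y : Fin d → ℤ) :
    y = seq v n ↔ ∃ c c' : Fin d → ℤ,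
      (∀ i, (Nat.beta (c i).toNat (0 : ℤ).toNat : ℤ) - (Nat.beta (c' i).toNat (0 : ℤ).toNat : ℤ) = base v i) ∧
      (∀ k : ℤ, 0 ≤ k → k < n → ∀ i,
        (Nat.beta (c i).toNat (k + 1).toNat : ℤ) - (Nat.beta (c' i).toNat (k + 1).toNat : ℤ) =
          step v k (fun i' => (Nat.beta (c i').toNat k.toNat : ℤ) - (Nat.beta (c' i').toNat k.toNat : ℤ)) i) ∧
      (∀ i, y i = (Nat.beta (c i).toNat (n : ℤ).toNat : ℤ) - (Nat.beta (c' i).toNat (n : ℤ).toNat : ℤ)) := by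
  constructor
  · rintro rfl
    have hcode : ∀ i : Fin d, ∃ cc' : ℕ × ℕ, ∀ k ≤ n, (Nat.beta cc'.1 k : ℤ) - (Nat.beta cc'.2 k : ℤ) = seq v k i := by
      intro i
      obtain ⟨c, c', h⟩ := exists_beta_pair_eq (fun k => seq v k i) n
      exact ⟨(c, c'), h⟩
    choose cc hcc using hcode
    refine ⟨fun i => ((cc i).1 : ℤ), fun i => ((cc i).2 : ℤ), fun i => ?_, fun k hk hkn i => ?_, fun i => ?_⟩
    · simp only [Int.toNat_natCast, Int.toNat_zero]
      rw [hcc i 0 (Nat.zero_le n), h0]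
    · obtain ⟨k, rfl⟩ := Int.eq_ofNat_of_zero_le hk
      have hkn' : k < n := by exact_mod_cast hkn
      have e1 : ((k : ℤ) + 1).toNat = k + 1 := by
        rw [show ((k : ℤ) + 1) = ((k + 1 : ℕ) : ℤ) by push_cast; ring, Int.toNat_natCast]
      simp only [Int.toNat_natCast, e1]
      rw [hcc i (k + 1) hkn', hS]
      congr 1
      funext i'
      rw [hcc i' k hkn'.le]
    · simp only [Int.toNat_natCast]
      rw [hcc i n le_rfl]
  · rintro ⟨c, c', hb, hs, hy⟩
    have key : ∀ k ≤ n, (fun i => (Nat.beta (c i).toNat k : ℤ) - (Nat.beta (c' i).toNat k : ℤ)) = seq v k := by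
      intro k
      induction k with
      | zero =>
        intro _
        funext i
        have := hb i
        simp only [Int.toNat_zero] at this
        rw [this, h0]
      | succ k ih =>
        intro hk
        funext i
        have := hs k (Int.natCast_nonneg k) (by exact_mod_cast hk) i
        have e1 : ((k : ℤ) + 1).toNat = k + 1 := by
          rw [show ((k : ℤ) + 1) = ((k + 1 : ℕ) : ℤ) by push_cast; ring, Int.toNat_natCast]
        simp only [Int.toNat_natCast, e1] at this
        rw [this, hS, ih (Nat.le_of_succ_le hk)]
    funext i
    rw [hy i, ← key n le_rfl]
    simp only [Int.toNat_natCast]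

/-- The definability half: the β-code description of the graph is a ring-definable condition on `(v, n, y) ∈ ℤ^σ × ℤ × ℤ^d`
(for `n ≥ 0`; at negative `n` the condition describes `seq v 0`, matching `Int.toNat`). [folklore] -/
theorem ringDefinable_natRec_graph [Finite σ] {base : (σ → ℤ) → Fin d → ℤ}
    {step : (σ → ℤ) → ℤ → (Fin d → ℤ) → Fin d → ℤ} {seq : (σ → ℤ) → ℕ → Fin d → ℤ}
    (h0 : ∀ v, seq v 0 = base v) (hS : ∀ v n, seq v (n + 1) = step v n (seq v n))
    (hbase : (∅ : Set ℤ).DefinableMap Language.ring base)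
    (hstep : (∅ : Set ℤ).DefinableMap Language.ring (fun w : (σ ⊕ Unit) ⊕ Fin d → ℤ =>
      step (fun s => w (Sum.inl (Sum.inl s))) (w (Sum.inl (Sum.inr ()))) (fun i => w (Sum.inr i)))) :
    (∅ : Set ℤ).Definable Language.ring {w : (σ ⊕ Unit) ⊕ Fin d → ℤ |
      (fun i => w (Sum.inr i)) = seq (fun s => w (Sum.inl (Sum.inl s))) (w (Sum.inl (Sum.inr ()))).toNat} := by
  -- the β-code formula
  have h : (∅ : Set ℤ).Definable Language.ring {w : (σ ⊕ Unit) ⊕ Fin d → ℤ | ∃ c : Fin d → ℤ, ∃ c' : Fin d → ℤ,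
      (∀ i, (Nat.beta (c i).toNat (0 : ℤ).toNat : ℤ) - (Nat.beta (c' i).toNat (0 : ℤ).toNat : ℤ) =
        base (fun s => w (Sum.inl (Sum.inl s))) i) ∧
      (∀ k : ℤ, 0 ≤ k → k < ((w (Sum.inl (Sum.inr ()))).toNat : ℤ) → ∀ i,
        (Nat.beta (c i).toNat (k + 1).toNat : ℤ) - (Nat.beta (c' i).toNat (k + 1).toNat : ℤ) =
          step (fun s => w (Sum.inl (Sum.inl s))) k
            (fun i' => (Nat.beta (c i').toNat k.toNat : ℤ) - (Nat.beta (c' i').toNat k.toNat : ℤ)) i) ∧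
      (∀ i, w (Sum.inr i) = (Nat.beta (c i).toNat ((w (Sum.inl (Sum.inr ()))).toNat : ℤ).toNat : ℤ) -
        (Nat.beta (c' i).toNat ((w (Sum.inl (Sum.inr ()))).toNat : ℤ).toNat : ℤ))} := by
    refine definable_setOf_existsBlock (definable_setOf_existsBlock (definable_setOf_and_params
      (definable_setOf_forallFin fun i => ?_) (definable_setOf_and_params
      (definable_setOf_forall_params (definable_setOf_imp_params (ringDefinable_setOf_nonneg (definableFun_proj_params _))
        (definable_setOf_imp_params
          (ringDefinable_setOf_lt (definableFun_proj_params _) (ringDefinableFun_toNat (definableFun_proj_params _)))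
          (definable_setOf_forallFin fun i => ?_))))
      (definable_setOf_forallFin fun i => ?_))))
    · -- base clause
      exact definable_setOf_eq_params
        (ringDefinableFun_sub (ringDefinableFun_natBeta (definableFun_proj_params _) ringDefinableFun_zero)
          (ringDefinableFun_natBeta (definableFun_proj_params _) ringDefinableFun_zero))
        (definableFun_reindex (hbase i) _)
    · -- step clause: compose `step · i` with the definable map reassembling `(v, k, z(k))`
      have hG : (∅ : Set ℤ).DefinableMap Language.ring
          (fun W : ((((σ ⊕ Unit) ⊕ Fin d) ⊕ Fin d) ⊕ Fin d) ⊕ Unit → ℤ =>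
            (Sum.elim (Sum.elim (fun s => W (Sum.inl (Sum.inl (Sum.inl (Sum.inl (Sum.inl s))))))
              (fun _ => W (Sum.inr ())))
              (fun i' => (Nat.beta (W (Sum.inl (Sum.inl (Sum.inr i')))).toNat (W (Sum.inr ())).toNat : ℤ) -
                (Nat.beta (W (Sum.inl (Sum.inr i'))).toNat (W (Sum.inr ())).toNat : ℤ)) :
              (σ ⊕ Unit) ⊕ Fin d → ℤ)) := by
        rintro ((s | u) | i')
        · exact definableFun_proj_params _
        · exact definableFun_proj_params _
        · exact ringDefinableFun_sub (ringDefinableFun_natBeta (definableFun_proj_params _) (definableFun_proj_params _))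
            (ringDefinableFun_natBeta (definableFun_proj_params _) (definableFun_proj_params _))
      exact definable_setOf_eq_params
        (ringDefinableFun_sub
          (ringDefinableFun_natBeta (definableFun_proj_params _)
            (ringDefinableFun_add (definableFun_proj_params _) ringDefinableFun_one))
          (ringDefinableFun_natBeta (definableFun_proj_params _)
            (ringDefinableFun_add (definableFun_proj_params _) ringDefinableFun_one)))
        ((hstep i).comp hG)
    · -- end clause
      exact definable_setOf_eq_params (definableFun_proj_params _)
        (ringDefinableFun_sub
          (ringDefinableFun_natBeta (definableFun_proj_params _) (ringDefinableFun_toNat (definableFun_proj_params _)))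
          (ringDefinableFun_natBeta (definableFun_proj_params _) (ringDefinableFun_toNat (definableFun_proj_params _))))
  convert h using 1
  ext w
  simp only [mem_setOf_eq]
  rw [natRec_graph_iff h0 hS]

/-- **RING-DEFINABLE PRIMITIVE RECURSION (vector state).**  If `seq v 0 = base v` and `seq v (n+1) = step v n (seq v n)` with
`base`, `step` ring-definable maps (`step` read on the tuple `(v, n, z) ∈ ℤ^σ × ℤ × ℤ^d`), then `(v, n) ↦ seq v n.toNat ∈ ℤ^d` is
a ring-definable map of `(v, n) ∈ ℤ^σ × ℤ` — Gödel's β-function device, for integer sequences as differences of natural ones.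
[folklore] -/
theorem ringDefinableMap_natRec [Finite σ] {base : (σ → ℤ) → Fin d → ℤ}
    {step : (σ → ℤ) → ℤ → (Fin d → ℤ) → Fin d → ℤ} {seq : (σ → ℤ) → ℕ → Fin d → ℤ}
    (h0 : ∀ v, seq v 0 = base v) (hS : ∀ v n, seq v (n + 1) = step v n (seq v n))
    (hbase : (∅ : Set ℤ).DefinableMap Language.ring base)
    (hstep : (∅ : Set ℤ).DefinableMap Language.ring (fun w : (σ ⊕ Unit) ⊕ Fin d → ℤ =>
      step (fun s => w (Sum.inl (Sum.inl s))) (w (Sum.inl (Sum.inr ()))) (fun i => w (Sum.inr i)))) :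
    (∅ : Set ℤ).DefinableMap Language.ring
      (fun w : σ ⊕ Unit → ℤ => seq (fun s => w (Sum.inl s)) (w (Sum.inr ())).toNat) := by
  intro j
  have hSgraph := ringDefinable_natRec_graph h0 hS hbase hstep
  -- graph of the `j`-th coordinate: `∃ y, (v, n, y) ∈ graph ∧ value = y j`
  have h : (∅ : Set ℤ).Definable Language.ring {t : Option (σ ⊕ Unit) → ℤ | ∃ y : Fin d → ℤ,
      (Sum.elim (fun x => t (some x)) y : (σ ⊕ Unit) ⊕ Fin d → ℤ) ∈ {w : (σ ⊕ Unit) ⊕ Fin d → ℤ |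
        (fun i => w (Sum.inr i)) = seq (fun s => w (Sum.inl (Sum.inl s))) (w (Sum.inl (Sum.inr ()))).toNat} ∧
      t none = y j} := by
    refine definable_setOf_existsBlock (definable_setOf_and_params ?_
      (definable_setOf_eq_params (definableFun_proj_params _) (definableFun_proj_params _)))
    convert hSgraph.preimage_comp (Sum.elim (fun x => Sum.inl (some x)) Sum.inr :
      (σ ⊕ Unit) ⊕ Fin d → Option (σ ⊕ Unit) ⊕ Fin d) using 1
    ext t
    simp only [mem_setOf_eq, mem_preimage, Function.comp_apply, Sum.elim_inl, Sum.elim_inr]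
  unfold Set.DefinableFun Function.tupleGraph
  convert h using 1
  ext t
  simp only [mem_setOf_eq, Function.comp_apply, Sum.elim_inl, Sum.elim_inr]
  constructor
  · intro ht
    exact ⟨seq (fun s => t (some (Sum.inl s))) (t (some (Sum.inr ()))).toNat, rfl, ht.symm⟩
  · rintro ⟨y, hy, hty⟩
    rw [hty]
    exact (congrFun hy j).symm

end RingZ

/-! ## Registered form -/

/-- Registered helper stub `ringDefinable_natRec_fin` of crux stmt-Schanuel-0969 (line kernel-arithmetic-selection, S8‴):
**ring-definable primitive recursion with integer-vector state** — for a recursion `seq v 0 = base v`,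
`seq v (n+1) = step v n (seq v n)` on `ℤ^d` with ring-definable `base : ℤ^k → ℤ^d` and `step : ℤ^k × ℤ × ℤ^d → ℤ^d`, the map
`(v, n) ↦ seq v n⁺` is ring-definable over `ℤ` (Gödel's β-function device). [folklore] -/
theorem ringDefinable_natRec_fin : ∀ [FirstOrder.Ring.CompatibleRing ℤ] (k d : ℕ) (base : (Fin k → ℤ) → Fin d → ℤ) (step : (Fin k → ℤ) → ℤ → (Fin d → ℤ) → Fin d → ℤ) (seq : (Fin k → ℤ) → ℕ → Fin d → ℤ), (∀ v, seq v 0 = base v) → (∀ v n, seq v (n + 1) = step v n (seq v n)) → (∅ : Set ℤ).DefinableMap FirstOrder.Language.ring base → (∅ : Set ℤ).DefinableMap FirstOrder.Language.ring (fun w : (Fin k ⊕ Unit) ⊕ Fin d → ℤ => step (fun s => w (Sum.inl (Sum.inl s))) (w (Sum.inl (Sum.inr ()))) (fun i => w (Sum.inr i))) → (∅ : Set ℤ).DefinableMap FirstOrder.Language.ring (fun w : Fin k ⊕ Unit → ℤ => seq (fun s => w (Sum.inl s)) (w (Sum.inr ())).toNat) := by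
  intro _ k d base step seq h0 hS hbase hstep
  exact ringDefinableMap_natRec h0 hS hbase hstep

end Summit.Schanuel.Schanuel.Cruxes.MinimalCounterexampleInAcl.KernelArithmeticSelection
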